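import Mathlib

/-!
# Route `RadicialJung`, crux `CleanModelsSuffice`, line `Sketch`: products of fs monoids with free monoids

Registered stub `stub_prodFreeMonoid` of the skeleton `Cruxes/CleanModelsSuffice/Lines/Sketch.lean`
(crux stmt-ResolutionOfSingularities-15883): if `P ⊆ ℤⁿ` is a finitely generated saturated additive
submonoid containing the unit vectors, then `P × ℕʳ ⊆ ℤ^{n+r}` (membership: the first `n`
coordinates lie in `P`, the last `r` are non-negative) is finitely generated, saturated and spans
`ℤ^{n+r}` — the toroidal Kato chart monoid of the line is the Kummer monoid times the free monoid on
the uncharged boundary parameters. General lemmas on submonoids of `ℤⁿ` (spanning from unit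
vectors, closure membership of non-negative vectors, saturation of monoids cut out by linear
inequalities) are proved here and reused by `RadicialJungCleanModelsSufficeKummerMonoid.lean`.
Everything is stated for submonoids CHARACTERISED by their membership predicate (no new definitions).
-/

set_option linter.dupNamespace false -- mandated namespace of this single-conjunct summit

namespace Summit.ResolutionOfSingularities.ResolutionOfSingularities.Theorems.RadicialJung.CleanModelsSuffice

open Finset

section General

variable {n : ℕ}

/-- `k • e_i = (0, …, k, …, 0)`. [folklore] -/
theorem nsmul_single_one (k : ℕ) (i : Fin n) :
    k • (Pi.single i (1 : ℤ) : Fin n → ℤ) = (Pi.single i (k : ℤ) : Fin n → ℤ) := by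
  ext x
  by_cases h : x = i
  · subst h; simp
  · simp [h]

/-- A submonoid of `ℤⁿ` containing all unit vectors spans `ℤⁿ` over `ℤ`. [folklore] -/
theorem span_eq_top_of_single_mem (N : AddSubmonoid (Fin n → ℤ))
    (h : ∀ i, Pi.single i (1 : ℤ) ∈ N) : Submodule.span ℤ (N : Set (Fin n → ℤ)) = ⊤ := by
  apply top_unique
  rw [← (Pi.basisFun ℤ (Fin n)).span_eq]
  refine Submodule.span_mono ?_
  rintro _ ⟨i, rfl⟩
  simpa [Pi.basisFun_apply] using h i

/-- A vector with non-negative entries lies in the closure of any set containing the unit vectors.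
[folklore] -/
theorem mem_closure_of_forall_nonneg (G : Set (Fin n → ℤ))
    (hG : ∀ i, Pi.single i (1 : ℤ) ∈ G) (c : Fin n → ℤ) (hc : ∀ j, 0 ≤ c j) :
    c ∈ AddSubmonoid.closure G := by
  have hsum : c = ∑ i : Fin n, (c i).toNat • Pi.single i (1 : ℤ) := by
    conv_lhs => rw [← Finset.univ_sum_single c]
    refine Finset.sum_congr rfl fun i _ => ?_
    rw [nsmul_single_one, Int.toNat_of_nonneg (hc i)]
  rw [hsum]
  exact AddSubmonoid.sum_mem _ fun i _ =>
    AddSubmonoid.nsmul_mem _ (AddSubmonoid.subset_closure (hG i)) _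

/-- A submonoid of `ℤⁿ` cut out by the non-negativity of values of additive maps is saturated: if
`k • c ∈ N` with `k > 0` then `c ∈ N`, provided membership is "`0 ≤ ℓ c` for all `ℓ ∈ Λ`".
[folklore] -/
theorem nsmulSaturated_of_linear (N : AddSubmonoid (Fin n → ℤ)) (Λ : Set ((Fin n → ℤ) →+ ℤ))
    (hN : ∀ c : Fin n → ℤ, c ∈ N ↔ ∀ ℓ ∈ Λ, 0 ≤ ℓ c) : N.NSMulSaturated := by
  intro k c hkc
  rcases Nat.eq_zero_or_pos k with hk | hk
  · exact Or.inl hk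
  · refine Or.inr ((hN c).2 fun ℓ hℓ => ?_)
    have h1 : 0 ≤ ℓ (k • c) := (hN _).1 hkc ℓ hℓ
    rw [map_nsmul, nsmul_eq_mul] at h1
    exact nonneg_of_mul_nonneg_right h1 (by exact_mod_cast hk)

end General

section Product

/-- Extension by zero `ℤⁿ → ℤ^{n+r}` is additive. [folklore] -/
theorem append_zero_add {n r : ℕ} (u u' : Fin n → ℤ) :
    Fin.append (u + u') (0 : Fin r → ℤ) = Fin.append u 0 + Fin.append u' 0 := by
  ext i
  refine Fin.addCases (fun i => ?_) (fun j => ?_) i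
  · simp [Fin.append_left]
  · simp [Fin.append_right]

/-- **Registered stub `stub_prodFreeMonoid`: product of a finitely generated saturated submonoid of
`ℤⁿ` containing the unit vectors with the free monoid `ℕʳ`**, inside `ℤ^{n+r}`: finitely generated,
saturated and spanning. [folklore] -/
theorem stub_prodFreeMonoid {n r : ℕ} (P : AddSubmonoid (Fin n → ℤ)) (hPfg : P.FG)
    (hPsat : P.NSMulSaturated)
    (hPsingle : ∀ i, Pi.single i (1 : ℤ) ∈ P) (P' : AddSubmonoid (Fin (n + r) → ℤ))
    (hP' : ∀ c : Fin (n + r) → ℤ, c ∈ P' ↔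
      (fun i : Fin n => c (Fin.castAdd r i)) ∈ P ∧ ∀ j : Fin r, 0 ≤ c (Fin.natAdd n j)) :
    P'.FG ∧ P'.NSMulSaturated ∧ Submodule.span ℤ (P' : Set (Fin (n + r) → ℤ)) = ⊤ := by
  classical
  have castAdd_ne_natAdd : ∀ (i : Fin n) (j : Fin r), Fin.castAdd r i ≠ Fin.natAdd n j := by
    intro i j h
    have h1 := congrArg Fin.val h
    simp only [Fin.val_castAdd, Fin.val_natAdd] at h1
    have := i.2
    omega
  -- extension by zero
  let ext : (Fin n → ℤ) →+ (Fin (n + r) → ℤ) :=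
    { toFun := fun u => Fin.append u 0
      map_zero' := by
        ext i
        refine Fin.addCases (fun i => ?_) (fun j => ?_) i
        · simp [Fin.append_left]
        · simp [Fin.append_right]
      map_add' := append_zero_add }
  have hext_cast : ∀ (u : Fin n → ℤ) (i : Fin n), ext u (Fin.castAdd r i) = u i := fun u i => by
    simp [ext, Fin.append_left]
  have hext_nat : ∀ (u : Fin n → ℤ) (j : Fin r), ext u (Fin.natAdd n j) = 0 := fun u j => by
    simp [ext, Fin.append_right]
  have hext_mem : ∀ u ∈ P, ext u ∈ P' := by
    intro u hu
    rw [hP']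
    constructor
    · have h1 : (fun i : Fin n => ext u (Fin.castAdd r i)) = u := funext (hext_cast u)
      rw [h1]
      exact hu
    · intro j
      rw [hext_nat]
  -- the unit vectors of the free part
  have hsn_cast : ∀ (j : Fin r) (i : Fin n),
      (Pi.single (Fin.natAdd n j) (1 : ℤ) : Fin (n + r) → ℤ) (Fin.castAdd r i) = 0 :=
    fun j i => Pi.single_eq_of_ne (castAdd_ne_natAdd i j) _
  have hsn_nat : ∀ (j j' : Fin r),
      (Pi.single (Fin.natAdd n j) (1 : ℤ) : Fin (n + r) → ℤ) (Fin.natAdd n j') =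
        if j' = j then 1 else 0 := by
    intro j j'
    by_cases h : j' = j
    · subst h; simp
    · rw [if_neg h, Pi.single_eq_of_ne]
      exact fun h' => h (Fin.natAdd_injective _ _ h')
  have hsingle' : ∀ j : Fin r, Pi.single (Fin.natAdd n j) (1 : ℤ) ∈ P' := by
    intro j
    rw [hP']
    constructor
    · have h1 : (fun i : Fin n => (Pi.single (Fin.natAdd n j) (1 : ℤ) : Fin (n + r) → ℤ)
          (Fin.castAdd r i)) = 0 := funext (hsn_cast j)
      rw [h1]
      exact zero_mem P
    · intro j'
      rw [hsn_nat]
      split_ifs <;> norm_num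
  -- decomposition of a vector of `ℤ^{n+r}`
  have hdec : ∀ c : Fin (n + r) → ℤ,
      c = ext (fun i => c (Fin.castAdd r i)) +
        ∑ j : Fin r, c (Fin.natAdd n j) • Pi.single (Fin.natAdd n j) (1 : ℤ) := by
    intro c
    ext i
    simp only [Pi.add_apply, Finset.sum_apply, Pi.smul_apply, smul_eq_mul]
    refine Fin.addCases (fun i => ?_) (fun j => ?_) i
    · rw [hext_cast, Finset.sum_eq_zero fun j _ => by rw [hsn_cast, mul_zero], add_zero]
    · rw [hext_nat, zero_add]
      simp only [hsn_nat, mul_ite, mul_one, mul_zero]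
      rw [Finset.sum_ite_eq]
      simp
  refine ⟨?_, ?_, ?_⟩
  · -- finite generation
    obtain ⟨S, hS⟩ := hPfg
    rw [AddSubmonoid.fg_iff]
    refine ⟨ext '' (S : Set (Fin n → ℤ)) ∪
        Set.range fun j : Fin r => (Pi.single (Fin.natAdd n j) (1 : ℤ) : Fin (n + r) → ℤ),
      le_antisymm ?_ ?_, (S.finite_toSet.image _).union (Set.finite_range _)⟩
    · rw [AddSubmonoid.closure_le]
      rintro x (⟨u, hu, rfl⟩ | ⟨j, rfl⟩)
      · exact hext_mem u (hS ▸ AddSubmonoid.subset_closure hu)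
      · exact hsingle' j
    · intro c hc
      obtain ⟨hcP, hcn⟩ := (hP' c).1 hc
      rw [hdec c]
      refine AddSubmonoid.add_mem _ ?_ ?_
      · have h1 : ext (fun i => c (Fin.castAdd r i)) ∈ (AddSubmonoid.closure (S : Set _)).map ext := by
          rw [hS]
          exact ⟨_, hcP, rfl⟩
        rw [AddMonoidHom.map_mclosure] at h1
        exact AddSubmonoid.closure_mono Set.subset_union_left h1
      · refine AddSubmonoid.sum_mem _ fun j _ => ?_
        have h2 : c (Fin.natAdd n j) • (Pi.single (Fin.natAdd n j) (1 : ℤ) : Fin (n + r) → ℤ) =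
            (c (Fin.natAdd n j)).toNat • (Pi.single (Fin.natAdd n j) (1 : ℤ) : Fin (n + r) → ℤ) := by
          rw [← natCast_zsmul, Int.toNat_of_nonneg (hcn j)]
        rw [h2]
        have hjG : (Pi.single (Fin.natAdd n j) (1 : ℤ) : Fin (n + r) → ℤ) ∈
            ext '' (S : Set (Fin n → ℤ)) ∪
              Set.range fun j : Fin r => (Pi.single (Fin.natAdd n j) (1 : ℤ) : Fin (n + r) → ℤ) :=
          Or.inr ⟨j, rfl⟩
        exact AddSubmonoid.nsmul_mem _ (AddSubmonoid.subset_closure hjG) _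
  · -- saturation
    intro k c hkc
    rcases Nat.eq_zero_or_pos k with hk | hk
    · exact Or.inl hk
    · right
      obtain ⟨h1, h2⟩ := (hP' _).1 hkc
      refine (hP' c).2 ⟨?_, fun j => ?_⟩
      · have h3 : (fun i : Fin n => (k • c) (Fin.castAdd r i)) = k • fun i => c (Fin.castAdd r i) := by
          ext i; simp
        rw [h3] at h1
        exact (hPsat h1).resolve_left hk.ne'
      · have h3 := h2 j
        simp only [Pi.smul_apply, nsmul_eq_mul] at h3
        exact nonneg_of_mul_nonneg_right h3 (by exact_mod_cast hk)
  · -- spanning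
    refine span_eq_top_of_single_mem P' fun i => ?_
    refine Fin.addCases (fun i => ?_) (fun j => hsingle' j) i
    rw [hP']
    constructor
    · have h1 : (fun i' : Fin n => (Pi.single (Fin.castAdd r i) (1 : ℤ) : Fin (n + r) → ℤ)
          (Fin.castAdd r i')) = Pi.single i 1 := by
        ext i'
        by_cases h : i' = i
        · subst h; simp
        · rw [Pi.single_eq_of_ne h, Pi.single_eq_of_ne]
          exact fun h' => h (Fin.castAdd_injective _ _ h')
      rw [h1]
      exact hPsingle i
    · intro j
      rw [Pi.single_eq_of_ne (castAdd_ne_natAdd i j).symm]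

end Product

end Summit.ResolutionOfSingularities.ResolutionOfSingularities.Theorems.RadicialJung.CleanModelsSuffice
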